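import Literature.Geometry.Kaehler.ComplexTorusMiddleHodgeLatticeDiscriminant
import Literature.Geometry.Kaehler.ComplexTorusHodgeClassesDimension
import Literature.Geometry.Kaehler.ComplexTorusSubtorusHodgeClass
import HarnessLib

/-!
# `Hdgᵖ(X, ℤ)` is a free abelian group of rank `dim_ℚ Bᵖ(X) ≤ C(g, p)²`; `rk Hdgᵖ(X, ℤ) + rk T = b_{2p}(X) = C(2g, 2p)`
# for the transcendental part `T = Hdg^⊥` of `H²ᵖ(X, ℤ)` (complex torus of dimension `g = 2p`)

Layer `Literature/Geometry/Kaehler`, namespace `Literature.Geometry.Kaehler.ComplexTorus`; lane `lit-hodgefound` (Track 2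
foundations library), seat p09, generation 30, row g30-#9. THEOREMS ONLY (0 definitions); no named fact, net debt 0.

For a complex torus `X = E/Φ(ℤ^ι)` (any universes for `ι`, `E`) the integral Hodge classes
`integralHodgeClassesIn Φ k p = Hᵏ(X, ℤ) ∩ Λ^{p,p}` (tree, A4-23 `ComplexTorusIntegralHodgeClasses`) form an additive subgroup
of the finite free `ℤ`-module `Hᵏ(X, ℤ) = integralForms Φ k` (rank `C(|ι|, k)`, the tree's `free_integralForms`,
`finite_integralForms`, `finrank_integralForms_eq_choose`):

* §1 **`Hdg^{k,p}(X, ℤ)` is a finitely generated free abelian group** (Lange Exercise 1.3.4 (10)(a) for `NS(X)`, here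
  for every `(k, p)`; the tree's p18 `moduleFree_neronSeveriGroup` is `p = 1`).
* §2 **`rk_ℤ Hdg^{k,p}(X, ℤ) = dim_ℚ B^{k,p}(X)`**: a `ℤ`-basis is `ℚ`-linearly independent
  (`LinearIndependent.iff_fractionRing`) and spans `B^{k,p}(X) = ℚ · Hdg^{k,p}(X, ℤ)` (the tree's
  `hodgeClassesIn_eq_span_integralHodgeClassesIn`). The `ComplexTorusCat` (universe-`0`) form of this statement is the tree's
  `finrank_integralHodgeClasses_eq` (p35, `HodgeTheory/ComplexTorusNeronSeveriIsogenyIndex`); here it is proved for bare period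
  maps `Φ` in arbitrary universes, where that object cannot be formed.
* §3 **bounds**: `rk Hdgᵖ(X, ℤ) ≤ h^{p,p}(X) = C(g, p)²` (Lange Prop. 1.1.23, the tree's `finrank_hodgeClasses_le_choose_sq`) and
  `rk Hdg^{k,p}(X, ℤ) ≤ b_k(X) = C(2g, k)`.
* §4 **the sublattice `Hdg ⊂ H^{2p}(X, ℤ)`** of rows g30-#4…#8 (torus of dimension `g = 2p`): `rk Hdg = rk Hdgᵖ(X, ℤ)`,
  **`rk Hdg + rk T = C(2g, 2p)`** (`T = Hdg^⊥`; Huybrechts' "the transcendental lattice is of rank `22 − ρ`", for tori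
  `6 − ρ(A)`, in every even dimension), **`rk T = C(2g, 2p) − dim_ℚ Bᵖ(X) ≥ C(2g, 2p) − C(g, p)²`**.

## The sources, verbatim

* H. Lange, *Abelian Varieties over the Complex Numbers* (2023), §7.2.2 (`H^{2p}_{Hodge}(X) = H^{2p}(X, ℚ) ∩ H^{p,p}`); §1.3.1
  Exercise 1.3.4 (10): "(a) `NS(X)` is a free abelian group of finite rank […] (b) the Picard number satisfies `ρ(X) ≤ h^{1,1}(X)`";
  §1.1.5 Prop. 1.1.23 (`h^{p,q} = C(g,p)·C(g,q)`).
* D. Huybrechts, *Lectures on K3 Surfaces* (2016), Ch. 3 §2.3 (PDF p. 59): "if `A` is an abelian surface, then its transcendental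
  lattice is of rank `6 − ρ(A) ≤ 5`"; Ch. 14 §0.1 (PDF p. 333): `Λ₁ ⊕ Λ₁^⊥ ⊂ Λ` of finite index (so `rk Λ₁ + rk Λ₁^⊥ = rk Λ`).
* W. Ebeling, *Lattices and Codes* (1994), §1.1 proof of Prop. 1.2 — `rk Λ + rk Λ^⊥ = rk Γ` for a primitive `Λ` in a unimodular
  `Γ`, through the tree's `finrank_add_finrank_orthogonal_of_forall_smul_mem`.

## References

* [cite: Lange2023AbelianVarietiesComplex, §7.2.2; §1.3.1 Exercise 1.3.4 (10); §1.1.5 Prop. 1.1.23]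
* [cite: Huybrechts2016K3, Ch. 3 §2.3 (PDF p. 59); Ch. 14 §0.1 (PDF p. 333)]
* [cite: Ebeling1994, §1.1 Prop. 1.2]
-/

noncomputable section

open Module Function
open LinearMap (BilinForm)

namespace Literature.Geometry.Kaehler.ComplexTorus

section Rank

variable {ι : Type*} [Fintype ι] {E : Type*} [NormedAddCommGroup E] [NormedSpace ℂ E] (Φ : (ι → ℝ) ≃L[ℝ] E)

omit [Fintype ι] in
/-- `Hdg^{k,p}(X, ℤ) ⊆ Hᵏ(X, ℤ)`. [cite: Lange2023AbelianVarietiesComplex, §7.2.2] -/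
theorem integralHodgeClassesIn_le_integralForms (k p : ℕ) : integralHodgeClassesIn Φ k p ≤ integralForms Φ k :=
  fun _ hγ ↦ hγ.1

omit [Fintype ι] in
/-- The inclusion `Hdg^{k,p}(X, ℤ) ↪ Hᵏ(X, ℤ)` as an injective `ℤ`-linear map into the lattice `Hᵏ(X, ℤ)`.
[cite: Lange2023AbelianVarietiesComplex, §7.2.2] -/
theorem exists_linearMap_integralHodgeClassesIn_injective (k p : ℕ) :
    ∃ f : integralHodgeClassesIn Φ k p →ₗ[ℤ] AddSubgroup.toIntSubmodule (integralForms Φ k),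
      Injective f ∧ ∀ x, ((f x : AddSubgroup.toIntSubmodule (integralForms Φ k)) : E [⋀^Fin k]→L[ℝ] ℂ) = x :=
  ⟨(AddSubgroup.inclusion (integralHodgeClassesIn_le_integralForms Φ k p)).toIntLinearMap,
    AddSubgroup.inclusion_injective (integralHodgeClassesIn_le_integralForms Φ k p), fun _ ↦ rfl⟩

/-! ## §1 `Hdg^{k,p}(X, ℤ)` is a finitely generated free abelian group -/

/-- **`Hdg^{k,p}(X, ℤ)` is finitely generated** (a subgroup of the lattice `Hᵏ(X, ℤ) ≅ ℤ^{C(2g,k)}`).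
[cite: Lange2023AbelianVarietiesComplex, §1.3.1 Exercise 1.3.4 (10)(a); §7.2.2] -/
theorem moduleFinite_integralHodgeClassesIn (k p : ℕ) : Module.Finite ℤ (integralHodgeClassesIn Φ k p) := by
  haveI := finite_integralForms Φ k
  obtain ⟨f, hf, -⟩ := exists_linearMap_integralHodgeClassesIn_injective Φ k p
  exact Module.Finite.of_injective f hf

/-- **`Hdg^{k,p}(X, ℤ)` is torsion-free.** [cite: Lange2023AbelianVarietiesComplex, §1.3.1 Exercise 1.3.4 (10)(a); §7.2.2] -/
theorem isTorsionFree_integralHodgeClassesIn (k p : ℕ) : Module.IsTorsionFree ℤ (integralHodgeClassesIn Φ k p) := by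
  haveI := free_integralForms Φ k
  obtain ⟨f, hf, -⟩ := exists_linearMap_integralHodgeClassesIn_injective Φ k p
  exact Function.Injective.moduleIsTorsionFree f hf (map_smul f)

/-- **`Hdg^{k,p}(X, ℤ)` is a free abelian group of finite rank** (finitely generated and torsion-free over the PID `ℤ`).
[cite: Lange2023AbelianVarietiesComplex, §1.3.1 Exercise 1.3.4 (10)(a); §7.2.2] -/
theorem moduleFree_integralHodgeClassesIn (k p : ℕ) : Module.Free ℤ (integralHodgeClassesIn Φ k p) := by
  haveI := moduleFinite_integralHodgeClassesIn Φ k p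
  haveI := isTorsionFree_integralHodgeClassesIn Φ k p
  infer_instance

/-- `Hdgᵖ(X, ℤ) = H^{2p}(X, ℤ) ∩ H^{p,p}` is a free abelian group of finite rank. [cite: Lange2023AbelianVarietiesComplex, §7.2.2] -/
theorem moduleFree_integralHodgeClasses (p : ℕ) : Module.Free ℤ (integralHodgeClasses Φ p) :=
  moduleFree_integralHodgeClassesIn Φ (2 * p) p

/-- `Hdgᵖ(X, ℤ)` is finitely generated. [cite: Lange2023AbelianVarietiesComplex, §7.2.2] -/
theorem moduleFinite_integralHodgeClasses (p : ℕ) : Module.Finite ℤ (integralHodgeClasses Φ p) :=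
  moduleFinite_integralHodgeClassesIn Φ (2 * p) p

/-! ## §2 `rk_ℤ Hdg^{k,p}(X, ℤ) = dim_ℚ B^{k,p}(X)` -/

/-- **`rk_ℤ Hdg^{k,p}(X, ℤ) = dim_ℚ B^{k,p}(X)`**: the rank of the free abelian group of integral Hodge classes equals the
dimension of the `ℚ`-vector space of rational Hodge classes (`B^{k,p}(X) = ℚ · Hdg^{k,p}(X, ℤ)`, the tree's
`hodgeClassesIn_eq_span_integralHodgeClassesIn`; a `ℤ`-basis of `Hdg^{k,p}(X, ℤ)` is `ℚ`-linearly independent and spans).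
The `ComplexTorusCat` form is the tree's `finrank_integralHodgeClasses_eq`; this is the universe-polymorphic statement for a
bare period map. [cite: Lange2023AbelianVarietiesComplex, §7.2.2; §1.3.1 Exercise 1.3.4 (10)(b)] -/
theorem finrank_integralHodgeClassesIn_eq_finrank_hodgeClassesIn (k p : ℕ) :
    finrank ℤ (integralHodgeClassesIn Φ k p) = finrank ℚ (hodgeClassesIn Φ k p) := by
  classical
  letI : LinearOrder ι := LinearOrder.lift' (Fintype.equivFin ι) (Fintype.equivFin ι).injective
  haveI := moduleFinite_integralHodgeClassesIn Φ k p
  haveI := moduleFree_integralHodgeClassesIn Φ k p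
  let b := Module.finBasis ℤ (integralHodgeClassesIn Φ k p)
  -- the inclusion `Hdg^{k,p}(X, ℤ) → Hᵏ(X, ℂ)` as a `ℤ`-linear map
  let L : integralHodgeClassesIn Φ k p →ₗ[ℤ] (E [⋀^Fin k]→L[ℝ] ℂ) := (integralHodgeClassesIn Φ k p).subtype.toIntLinearMap
  have hL : Injective L := Subtype.coe_injective
  have hgZ : LinearIndependent ℤ (L ∘ b) := b.linearIndependent.map' L (LinearMap.ker_eq_bot.2 hL)
  have hgQ : LinearIndependent ℚ (L ∘ b) := (LinearIndependent.iff_fractionRing ℤ ℚ).1 hgZ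
  have hspan : Submodule.span ℚ (Set.range (L ∘ b)) = hodgeClassesIn Φ k p := by
    rw [hodgeClassesIn_eq_span_integralHodgeClassesIn]
    refine le_antisymm (Submodule.span_mono ?_) (Submodule.span_le.2 ?_)
    · rintro _ ⟨i, rfl⟩
      exact (b i).2
    · rintro γ hγ
      have hγ' : γ = L ⟨γ, hγ⟩ := rfl
      rw [hγ', ← b.sum_repr ⟨γ, hγ⟩, map_sum]
      refine Submodule.sum_mem _ fun i _ ↦ ?_
      rw [map_smul]
      exact Submodule.smul_of_tower_mem _ _ (Submodule.subset_span ⟨i, rfl⟩)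
  rw [← hspan, finrank_span_eq_card hgQ, Fintype.card_fin]

/-- **`ρ_p(X) := rk_ℤ Hdgᵖ(X, ℤ) = dim_ℚ Bᵖ(X)`** (`Bᵖ(X) = H^{2p}(X, ℚ) ∩ H^{p,p}`). [cite: Lange2023AbelianVarietiesComplex, §7.2.2] -/
theorem finrank_integralHodgeClasses_eq_finrank_hodgeClasses (p : ℕ) :
    finrank ℤ (integralHodgeClasses Φ p) = finrank ℚ (hodgeClasses Φ p) :=
  finrank_integralHodgeClassesIn_eq_finrank_hodgeClassesIn Φ (2 * p) p

/-! ## §3 Bounds: `rk Hdgᵖ(X, ℤ) ≤ h^{p,p} = C(g, p)²` and `≤ b_k = C(2g, k)` -/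

/-- **`rk_ℤ Hdgᵖ(X, ℤ) ≤ h^{p,p}(X) = C(g, p)²`**, `g = dim_ℂ X` (Lange Exercise 1.3.4 (10)(b) "`ρ(X) ≤ h^{1,1}(X)`" in every
codimension; `h^{p,p} = C(g,p)·C(g,p)`, Prop. 1.1.23). [cite: Lange2023AbelianVarietiesComplex, §1.3.1 Exercise 1.3.4 (10)(b); §1.1.5 Prop. 1.1.23] -/
theorem finrank_integralHodgeClasses_le_choose_sq [FiniteDimensional ℂ E] (p : ℕ) :
    finrank ℤ (integralHodgeClasses Φ p) ≤ ((finrank ℂ E).choose p) ^ 2 := by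
  rw [finrank_integralHodgeClasses_eq_finrank_hodgeClasses]
  exact finrank_hodgeClasses_le_choose_sq Φ p

/-- **`rk_ℤ Hdg^{k,p}(X, ℤ) ≤ b_k(X) = C(2g, k)`** (a subgroup of `Hᵏ(X, ℤ) ≅ ℤ^{C(2g,k)}`). [cite: Lange2023AbelianVarietiesComplex, §1.1.3 Exercise 1.1.6 (8); §7.2.2] -/
theorem finrank_integralHodgeClassesIn_le_choose (k p : ℕ) :
    finrank ℤ (integralHodgeClassesIn Φ k p) ≤ (Fintype.card ι).choose k := by
  haveI := finite_integralForms Φ k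
  haveI := free_integralForms Φ k
  obtain ⟨f, hf, -⟩ := exists_linearMap_integralHodgeClassesIn_injective Φ k p
  rw [← finrank_integralForms_eq_choose Φ k]
  exact LinearMap.finrank_le_finrank_of_injective hf

end Rank

/-! ## §4 The sublattice `Hdg ⊂ H^{2p}(X, ℤ)` and its transcendental complement `T` (torus of dimension `2p`) -/

section Lattice

variable {ι : Type*} [Fintype ι] [DecidableEq ι] {E : Type*} [NormedAddCommGroup E] [NormedSpace ℂ E]
  (Φ : (ι → ℝ) ≃L[ℝ] E) {g p : ℕ} (e : Fin (2 * g) ≃ ι) (h : 2 * p + 2 * p = 2 * g)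

omit [Fintype ι] [DecidableEq ι] in
/-- The sublattice `Hdg ⊂ H^{2p}(X, ℤ)` of rows g30-#4…#8 is (tautologically) isomorphic to `Hdgᵖ(X, ℤ)`; in particular
**`rk Hdg = rk Hdgᵖ(X, ℤ)`**. [cite: Lange2023AbelianVarietiesComplex, §7.2.2] -/
theorem finrank_hodgeSublattice_eq :
    finrank ℤ (AddSubgroup.toIntSubmodule ((integralHodgeClasses Φ p).addSubgroupOf (integralForms Φ (2 * p)))) =
      finrank ℤ (integralHodgeClasses Φ p) := by
  have hleS : ∀ s : integralHodgeClasses Φ p, (s : E [⋀^Fin (2 * p)]→L[ℝ] ℂ) ∈ integralForms Φ (2 * p) :=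
    fun s ↦ ((mem_integralHodgeClasses_iff Φ).1 s.2).1
  let eS : integralHodgeClasses Φ p ≃ₗ[ℤ]
      (AddSubgroup.toIntSubmodule ((integralHodgeClasses Φ p).addSubgroupOf (integralForms Φ (2 * p)))) :=
    { toFun := fun s ↦ ⟨⟨s, hleS s⟩, (mem_hodgeSublattice_iff Φ).2 s.2⟩
      invFun := fun y ↦ ⟨((y : AddSubgroup.toIntSubmodule ((integralHodgeClasses Φ p).addSubgroupOf
          (integralForms Φ (2 * p)))) : integralForms Φ (2 * p)), (mem_hodgeSublattice_iff Φ).1 y.2⟩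
      map_add' := fun _ _ ↦ rfl
      map_smul' := fun _ _ ↦ rfl
      left_inv := fun _ ↦ rfl
      right_inv := fun _ ↦ rfl }
  exact eS.symm.finrank_eq

omit [Fintype ι] [DecidableEq ι] in
/-- `rk Hdg = dim_ℚ Bᵖ(X)` for the sublattice `Hdg ⊂ H^{2p}(X, ℤ)`. [cite: Lange2023AbelianVarietiesComplex, §7.2.2] -/
theorem finrank_hodgeSublattice_eq_finrank_hodgeClasses [Fintype ι] :
    finrank ℤ (AddSubgroup.toIntSubmodule ((integralHodgeClasses Φ p).addSubgroupOf (integralForms Φ (2 * p)))) =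
      finrank ℚ (hodgeClasses Φ p) := by
  rw [finrank_hodgeSublattice_eq, finrank_integralHodgeClasses_eq_finrank_hodgeClasses]

/-- **`rk Hdg + rk T = b_{2p}(X) = C(2g, 2p)`** for the Hodge lattice `Hdg ⊂ H^{2p}(X, ℤ)` of a complex torus of dimension `2p`
and its transcendental complement `T = Hdg^⊥` (`Hdg` primitive in the unimodular `H^{2p}(X, ℤ)`: `Hdg ⊕ T` has full rank).
[cite: Huybrechts2016K3, Ch. 14 §0.1 (PDF p. 333); Ch. 3 §2.3 (PDF p. 59)] [cite: Ebeling1994, §1.1 Prop. 1.2] -/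
theorem finrank_hodgeSublattice_add_finrank_orthogonal {B : BilinForm ℤ (integralForms Φ (2 * p))}
    (hB : ∀ x y : integralForms Φ (2 * p), ((B x y : ℤ) : ℂ) =
      poincarePairing Φ e h (x : E [⋀^Fin (2 * p)]→L[ℝ] ℂ) (y : E [⋀^Fin (2 * p)]→L[ℝ] ℂ)) :
    finrank ℤ (AddSubgroup.toIntSubmodule ((integralHodgeClasses Φ p).addSubgroupOf (integralForms Φ (2 * p)))) +
      finrank ℤ (B.orthogonal (AddSubgroup.toIntSubmodule
        ((integralHodgeClasses Φ p).addSubgroupOf (integralForms Φ (2 * p))))) = (2 * g).choose (2 * p) := by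
  haveI : Module.Free ℤ (integralForms Φ (2 * p)) := free_integralForms Φ (2 * p)
  haveI : Module.Finite ℤ (integralForms Φ (2 * p)) := finite_integralForms Φ (2 * p)
  haveI : B.IsPerfPair := isUnimodular_of_eq_poincarePairing_middle Φ e h hB
  have hι : Fintype.card ι = 2 * g := by rw [← Fintype.card_congr e, Fintype.card_fin]
  have hrk : finrank ℤ (integralForms Φ (2 * p)) = (2 * g).choose (2 * p) := by
    rw [← hι]; exact finrank_integralForms_eq_choose Φ (2 * p)
  rw [← hrk]
  exact LinearMap.BilinForm.finrank_add_finrank_orthogonal_of_forall_smul_mem B _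
    (isSymm_of_eq_poincarePairing_middle Φ e h (even_two_mul p) hB)
    (fun k x hk hx ↦ mem_hodgeSublattice_of_smul_mem Φ hk hx)

/-- **`rk T = C(2g, 2p) − dim_ℚ Bᵖ(X)`**: the rank of the transcendental part of `H^{2p}(X, ℤ)` (Huybrechts: "if `A` is an
abelian surface, then its transcendental lattice is of rank `6 − ρ(A)`" — the case `p = 1`: `C(4, 2) = 6`).
[cite: Huybrechts2016K3, Ch. 3 §2.3 (PDF p. 59)] [cite: Lange2023AbelianVarietiesComplex, §7.2.2] -/
theorem finrank_orthogonal_hodgeSublattice_eq {B : BilinForm ℤ (integralForms Φ (2 * p))}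
    (hB : ∀ x y : integralForms Φ (2 * p), ((B x y : ℤ) : ℂ) =
      poincarePairing Φ e h (x : E [⋀^Fin (2 * p)]→L[ℝ] ℂ) (y : E [⋀^Fin (2 * p)]→L[ℝ] ℂ)) :
    finrank ℤ (B.orthogonal (AddSubgroup.toIntSubmodule
        ((integralHodgeClasses Φ p).addSubgroupOf (integralForms Φ (2 * p))))) =
      (2 * g).choose (2 * p) - finrank ℚ (hodgeClasses Φ p) := by
  have h1 := finrank_hodgeSublattice_add_finrank_orthogonal Φ e h hB
  rw [finrank_hodgeSublattice_eq_finrank_hodgeClasses Φ] at h1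
  omega

/-- **`rk T ≥ C(2g, 2p) − C(g, p)²`**: the transcendental part of `H^{2p}(X, ℤ)` is large (`dim_ℚ Bᵖ(X) ≤ h^{p,p} = C(g,p)²`;
for an abelian surface `rk T_X ≥ 6 − 4 = 2`). [cite: Lange2023AbelianVarietiesComplex, §1.3.1 Exercise 1.3.4 (10)(b); §1.1.5 Prop. 1.1.23]
[cite: Huybrechts2016K3, Ch. 3 §2.3 (PDF p. 59)] -/
theorem choose_sub_choose_sq_le_finrank_orthogonal_hodgeSublattice {B : BilinForm ℤ (integralForms Φ (2 * p))}
    (hB : ∀ x y : integralForms Φ (2 * p), ((B x y : ℤ) : ℂ) =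
      poincarePairing Φ e h (x : E [⋀^Fin (2 * p)]→L[ℝ] ℂ) (y : E [⋀^Fin (2 * p)]→L[ℝ] ℂ)) :
    (2 * g).choose (2 * p) - (g.choose p) ^ 2 ≤
      finrank ℤ (B.orthogonal (AddSubgroup.toIntSubmodule
        ((integralHodgeClasses Φ p).addSubgroupOf (integralForms Φ (2 * p))))) := by
  haveI : FiniteDimensional ℝ E := LinearEquiv.finiteDimensional Φ.toLinearEquiv
  haveI : FiniteDimensional ℂ E := Module.Finite.of_restrictScalars_finite ℝ ℂ E
  have hg : finrank ℂ E = g := by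
    have h2 := finrank_add_finrank_eq_card Φ
    rw [← Fintype.card_congr e, Fintype.card_fin] at h2
    omega
  have hle := finrank_hodgeClasses_le_choose_sq Φ p
  rw [hg] at hle
  rw [finrank_orthogonal_hodgeSublattice_eq Φ e h hB]
  omega

end Lattice

end Literature.Geometry.Kaehler.ComplexTorus

end
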